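import Summits.CriticalPhenomena.PercolationContinuityZ3.Theorems.PercNearOneGluingNoHeavyLowerTailForestRayleighStepsTwo
import HarnessLib

/-!
# Weighted forest negative correlation on graphs of tree-width ≤ 2 — V: series vertex avoiding `e, f`, both edges free

Notation as in `…ForestRayleighTools`: `Z(D;K) = Σ_{G ⊆ D, ⟨G ∪ K⟩ acyclic} ∏_{g∈G} w g` and the
Rayleigh inequality `(R)(D;K;e,f) : Z(D;K∪{e,f})·Z(D;K) ≤ Z(D;K∪{e})·Z(D;K∪{f})`.

`lsm_series_free_free`: the degree-two vertex `v` has two FREE edges `vu₁, vu₂ ∈ D` (activities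
`w₁, w₂`), both different from `e, f`; chord `h = u₁u₂ ≠ f`. Eliminating `v` gives
`Z(D;X) = (1 + w₁ + w₂)·Z(D₀;X) + w₁w₂·Z(D₀;X ∪ h)`, i.e. the instance `D₀ ∪ h` with the chord of
activity `w₁w₂/(1 + w₁ + w₂)` (added to `w h` if `h` was already free), scaled by `1 + w₁ + w₂`
(Semple–Welsh's substitution `y′ = y_b y_c/(y_b + y_c + 1)`); so `(R)(D;K;e,f)` follows from
`(R)` for that re-weighted instance, and from `(R)(D₀;K;e,f)` when `h ∈ K` or `h = e`.
Graph-language form of Semple–Welsh, *Negative correlation in graphs and matroids*, CPC 17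
(2008), Prop. 3.7 (series extension). Theorems only; no definitions, no `sorry`.
-/

open Finset SimpleGraph
open scoped Classical

namespace Summit.CriticalPhenomena.PercolationContinuityZ3.Theorems.ForestRayleigh

variable {V : Type*} [Fintype V] [DecidableEq V]

omit [Fintype V] [DecidableEq V] in
/-- Real-algebra step (`h ∈ K`): all four partition functions scale by `1 + t₂ + t₁`. [elementary] -/
theorem real_dd_scale_le {P A B C t₁ t₂ : ℝ} (h : P * A ≤ B * C) :
    ((P + t₂ * P) + t₁ * P) * ((A + t₂ * A) + t₁ * A) ≤
      ((B + t₂ * B) + t₁ * B) * ((C + t₂ * C) + t₁ * C) := by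
  have e : ∀ X : ℝ, (X + t₂ * X) + t₁ * X = (1 + t₂ + t₁) * X := fun X => by ring
  simp only [e]
  calc (1 + t₂ + t₁) * P * ((1 + t₂ + t₁) * A) = (1 + t₂ + t₁) * (1 + t₂ + t₁) * (P * A) := by ring
    _ ≤ (1 + t₂ + t₁) * (1 + t₂ + t₁) * (B * C) :=
        mul_le_mul_of_nonneg_left h (mul_self_nonneg _)
    _ = _ := by ring

omit [Fintype V] [DecidableEq V] in
/-- Real-algebra step (`h = e`): `P A ≤ B C` gives
`((P + t₂P) + t₁P)((A + t₂A) + t₁(A + t₂B)) ≤ ((B + t₂B) + t₁B)((C + t₂C) + t₁(C + t₂P))`,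
the difference being `(1 + t₁ + t₂)²(BC − PA)`. [elementary] -/
theorem real_dd_e_le {P A B C t₁ t₂ : ℝ} (h : P * A ≤ B * C) :
    ((P + t₂ * P) + t₁ * P) * ((A + t₂ * A) + t₁ * (A + t₂ * B)) ≤
      ((B + t₂ * B) + t₁ * B) * ((C + t₂ * C) + t₁ * (C + t₂ * P)) := by
  have e : ((B + t₂ * B) + t₁ * B) * ((C + t₂ * C) + t₁ * (C + t₂ * P)) -
      ((P + t₂ * P) + t₁ * P) * ((A + t₂ * A) + t₁ * (A + t₂ * B)) =
        (1 + t₁ + t₂) ^ 2 * (B * C - P * A) := by ring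
  nlinarith [mul_nonneg (sq_nonneg (1 + t₁ + t₂)) (sub_nonneg.2 h), e]

omit [Fintype V] [DecidableEq V] in
/-- Real-algebra step (`h` free, already present with activity `s`): with `c(1+t₁+t₂) = t₁t₂` each
factor `((A + sB) + t₂(A + sB)) + t₁((A + sB) + t₂B)` equals `(1+t₁+t₂)(A + (s+c)B)`. [elementary] -/
theorem real_dd_absorb_le {A₁ B₁ A₂ B₂ A₃ B₃ A₄ B₄ s c t₁ t₂ : ℝ}
    (h : (A₁ + (s + c) * B₁) * (A₂ + (s + c) * B₂) ≤ (A₃ + (s + c) * B₃) * (A₄ + (s + c) * B₄))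
    (hc : c * (1 + t₁ + t₂) = t₁ * t₂) :
    (((A₁ + s * B₁) + t₂ * (A₁ + s * B₁)) + t₁ * ((A₁ + s * B₁) + t₂ * B₁)) *
        (((A₂ + s * B₂) + t₂ * (A₂ + s * B₂)) + t₁ * ((A₂ + s * B₂) + t₂ * B₂)) ≤
      (((A₃ + s * B₃) + t₂ * (A₃ + s * B₃)) + t₁ * ((A₃ + s * B₃) + t₂ * B₃)) *
        (((A₄ + s * B₄) + t₂ * (A₄ + s * B₄)) + t₁ * ((A₄ + s * B₄) + t₂ * B₄)) := by
  have e : ∀ A B : ℝ, ((A + s * B) + t₂ * (A + s * B)) + t₁ * ((A + s * B) + t₂ * B) =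
      (1 + t₁ + t₂) * (A + (s + c) * B) := fun A B => by linear_combination (-B) * hc
  rw [e, e, e, e]
  calc (1 + t₁ + t₂) * (A₁ + (s + c) * B₁) * ((1 + t₁ + t₂) * (A₂ + (s + c) * B₂))
        = (1 + t₁ + t₂) * (1 + t₁ + t₂) * ((A₁ + (s + c) * B₁) * (A₂ + (s + c) * B₂)) := by ring
    _ ≤ (1 + t₁ + t₂) * (1 + t₁ + t₂) * ((A₃ + (s + c) * B₃) * (A₄ + (s + c) * B₄)) :=
        mul_le_mul_of_nonneg_left h (mul_self_nonneg _)
    _ = _ := by ring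

omit [Fintype V] [DecidableEq V] in
/-- Real-algebra step (`h` new, activity `c` with `c(1+t₁+t₂) = t₁t₂`): each factor
`(A + t₂A) + t₁(A + t₂B)` equals `(1+t₁+t₂)(A + cB)`. [elementary] -/
theorem real_dd_new_le {A₁ B₁ A₂ B₂ A₃ B₃ A₄ B₄ c t₁ t₂ : ℝ}
    (h : (A₁ + c * B₁) * (A₂ + c * B₂) ≤ (A₃ + c * B₃) * (A₄ + c * B₄))
    (hc : c * (1 + t₁ + t₂) = t₁ * t₂) :
    ((A₁ + t₂ * A₁) + t₁ * (A₁ + t₂ * B₁)) * ((A₂ + t₂ * A₂) + t₁ * (A₂ + t₂ * B₂)) ≤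
      ((A₃ + t₂ * A₃) + t₁ * (A₃ + t₂ * B₃)) * ((A₄ + t₂ * A₄) + t₁ * (A₄ + t₂ * B₄)) := by
  have e : ∀ A B : ℝ, (A + t₂ * A) + t₁ * (A + t₂ * B) = (1 + t₁ + t₂) * (A + c * B) :=
    fun A B => by linear_combination (-B) * hc
  rw [e, e, e, e]
  calc (1 + t₁ + t₂) * (A₁ + c * B₁) * ((1 + t₁ + t₂) * (A₂ + c * B₂))
        = (1 + t₁ + t₂) * (1 + t₁ + t₂) * ((A₁ + c * B₁) * (A₂ + c * B₂)) := by ring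
    _ ≤ (1 + t₁ + t₂) * (1 + t₁ + t₂) * ((A₃ + c * B₃) * (A₄ + c * B₄)) :=
        mul_le_mul_of_nonneg_left h (mul_self_nonneg _)
    _ = _ := by ring

/-- **Series vertex with both edges free.** `D = D₀ ∪ {vu₁, vu₂}`, `v` meets no other edge of the
instance, `h = u₁u₂ ≠ f`: `(R)(D;K;e,f)` follows from `(R)` for `D₀ ∪ h` with `h` re-weighted to `c`
(all `c ≥ 0`), and from `(R)(D₀;K;e,f)` when `h ∈ K` or `h = e`. [S–W Prop. 3.7, series case] -/
theorem lsm_series_free_free (w : Sym2 V → ℝ) (hw : ∀ x, 0 ≤ w x) (D₀ K : Finset (Sym2 V))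
    (e f : Sym2 V) {v u₁ u₂ : V}
    (hDK : ∀ x ∈ D₀ ∪ insert e (insert f (insert s(v, u₂) (insert s(v, u₁) K))), ¬x.IsDiag)
    (hv : ∀ x ∈ D₀ ∪ insert e (insert f K), v ∉ x) (hu : u₁ ≠ u₂) (hhf : s(u₁, u₂) ≠ f)
    (heD : e ∉ D₀) (heK : e ∉ K)
    (hred₁ : ∀ c : ℝ, 0 ≤ c → s(u₁, u₂) ∉ K → s(u₁, u₂) ≠ e →
      (∑ G ∈ (insert s(u₁, u₂) (D₀.erase s(u₁, u₂))).powerset.filter (fun G =>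
        (fromEdgeSet ((G ∪ (insert e (insert f K)) : Finset (Sym2 V)) : Set (Sym2 V))).IsAcyclic), ∏ x ∈ G, Function.update w s(u₁, u₂) c x) *
      (∑ G ∈ (insert s(u₁, u₂) (D₀.erase s(u₁, u₂))).powerset.filter (fun G =>
        (fromEdgeSet ((G ∪ K : Finset (Sym2 V)) : Set (Sym2 V))).IsAcyclic), ∏ x ∈ G, Function.update w s(u₁, u₂) c x) ≤
    (∑ G ∈ (insert s(u₁, u₂) (D₀.erase s(u₁, u₂))).powerset.filter (fun G =>
        (fromEdgeSet ((G ∪ (insert e K) : Finset (Sym2 V)) : Set (Sym2 V))).IsAcyclic), ∏ x ∈ G, Function.update w s(u₁, u₂) c x) *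
      (∑ G ∈ (insert s(u₁, u₂) (D₀.erase s(u₁, u₂))).powerset.filter (fun G =>
        (fromEdgeSet ((G ∪ (insert f K) : Finset (Sym2 V)) : Set (Sym2 V))).IsAcyclic), ∏ x ∈ G, Function.update w s(u₁, u₂) c x))
    (hred₂ : s(u₁, u₂) ∈ K ∨ s(u₁, u₂) = e →
      (∑ G ∈ D₀.powerset.filter (fun G =>
        (fromEdgeSet ((G ∪ (insert e (insert f K)) : Finset (Sym2 V)) : Set (Sym2 V))).IsAcyclic), ∏ x ∈ G, w x) *
      (∑ G ∈ D₀.powerset.filter (fun G =>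
        (fromEdgeSet ((G ∪ K : Finset (Sym2 V)) : Set (Sym2 V))).IsAcyclic), ∏ x ∈ G, w x) ≤
    (∑ G ∈ D₀.powerset.filter (fun G =>
        (fromEdgeSet ((G ∪ (insert e K) : Finset (Sym2 V)) : Set (Sym2 V))).IsAcyclic), ∏ x ∈ G, w x) *
      (∑ G ∈ D₀.powerset.filter (fun G =>
        (fromEdgeSet ((G ∪ (insert f K) : Finset (Sym2 V)) : Set (Sym2 V))).IsAcyclic), ∏ x ∈ G, w x)) :
    (∑ G ∈ (insert s(v, u₁) (insert s(v, u₂) D₀)).powerset.filter (fun G =>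
        (fromEdgeSet ((G ∪ (insert e (insert f K)) : Finset (Sym2 V)) : Set (Sym2 V))).IsAcyclic), ∏ x ∈ G, w x) *
      (∑ G ∈ (insert s(v, u₁) (insert s(v, u₂) D₀)).powerset.filter (fun G =>
        (fromEdgeSet ((G ∪ K : Finset (Sym2 V)) : Set (Sym2 V))).IsAcyclic), ∏ x ∈ G, w x) ≤
    (∑ G ∈ (insert s(v, u₁) (insert s(v, u₂) D₀)).powerset.filter (fun G =>
        (fromEdgeSet ((G ∪ (insert e K) : Finset (Sym2 V)) : Set (Sym2 V))).IsAcyclic), ∏ x ∈ G, w x) *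
      (∑ G ∈ (insert s(v, u₁) (insert s(v, u₂) D₀)).powerset.filter (fun G =>
        (fromEdgeSet ((G ∪ (insert f K) : Finset (Sym2 V)) : Set (Sym2 V))).IsAcyclic), ∏ x ∈ G, w x) := by
  have hvu₁ : v ≠ u₁ := fun hh => hDK s(v, u₁) (by simp) (Sym2.mk_isDiag_iff.2 hh)
  have hvu₂ : v ≠ u₂ := fun hh => hDK s(v, u₂) (by simp) (Sym2.mk_isDiag_iff.2 hh)
  have hg₂D : s(v, u₂) ∉ D₀ := fun hh => hv _ (Finset.mem_union_left _ hh) (Sym2.mem_mk_left _ _)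
  have hg₁D : s(v, u₁) ∉ insert s(v, u₂) D₀ := by
    rw [Finset.mem_insert, not_or]
    exact ⟨fun hh => hu (Sym2.congr_right.1 hh),
      fun hh => hv _ (Finset.mem_union_left _ hh) (Sym2.mem_mk_left _ _)⟩
  have hnd : ¬(s(u₁, u₂) : Sym2 V).IsDiag := fun hh => hu (Sym2.mk_isDiag_iff.1 hh)
  have hef : s(u₁, u₂) = e → e ≠ f := fun hh => hh ▸ hhf
  have ndX : ∀ D' X : Finset (Sym2 V), D' ⊆ D₀ → X ⊆ insert e (insert f K) →
      ∀ x ∈ D' ∪ X, ¬x.IsDiag := by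
    intro D' X hD' hX x hx
    apply hDK x
    rcases Finset.mem_union.1 hx with hx | hx
    · exact Finset.mem_union_left _ (hD' hx)
    · apply Finset.mem_union_right
      have hx' := hX hx
      simp only [Finset.mem_insert] at hx' ⊢
      rcases hx' with hx' | hx' | hx'
      · exact Or.inl hx'
      · exact Or.inr (Or.inl hx')
      · exact Or.inr (Or.inr (Or.inr (Or.inr hx')))
  have hvX : ∀ D' X : Finset (Sym2 V), D' ⊆ D₀ → X ⊆ insert e (insert f K) →
      ∀ x ∈ D' ∪ X, v ∉ x := fun D' X hD' hX x hx =>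
    hv x (Finset.union_subset_union hD' hX hx)
  have X₀ : K ⊆ insert e (insert f K) := (Finset.subset_insert _ _).trans (Finset.subset_insert _ _)
  have Xₑ : insert e K ⊆ insert e (insert f K) :=
    Finset.insert_subset_insert e (Finset.subset_insert _ _)
  have X_f : insert f K ⊆ insert e (insert f K) := Finset.subset_insert _ _
  have X₂ : insert e (insert f K) ⊆ insert e (insert f K) := subset_rfl
  have pend : ∀ X : Finset (Sym2 V), X ⊆ insert e (insert f K) →
      (∑ G ∈ D₀.powerset.filter (fun G =>
        (fromEdgeSet ((G ∪ (insert s(v, u₂) X) : Finset (Sym2 V)) : Set (Sym2 V))).IsAcyclic), ∏ x ∈ G, w x) = (∑ G ∈ D₀.powerset.filter (fun G =>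
        (fromEdgeSet ((G ∪ X : Finset (Sym2 V)) : Set (Sym2 V))).IsAcyclic), ∏ x ∈ G, w x) ∧
      (∑ G ∈ D₀.powerset.filter (fun G =>
        (fromEdgeSet ((G ∪ (insert s(v, u₁) X) : Finset (Sym2 V)) : Set (Sym2 V))).IsAcyclic), ∏ x ∈ G, w x) = (∑ G ∈ D₀.powerset.filter (fun G =>
        (fromEdgeSet ((G ∪ X : Finset (Sym2 V)) : Set (Sym2 V))).IsAcyclic), ∏ x ∈ G, w x) := fun X hX =>
    ⟨forestsW_pin_pendant w D₀ X (ndX _ _ subset_rfl hX) (hvX _ _ subset_rfl hX) hvu₂.symm,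
      forestsW_pin_pendant w D₀ X (ndX _ _ subset_rfl hX) (hvX _ _ subset_rfl hX) hvu₁.symm⟩
  -- split off `vu₁`, then `vu₂`, and drop the pendant copies
  rw [forestsW_insert_split w _ _ hg₁D, forestsW_insert_split w _ _ hg₁D,
    forestsW_insert_split w _ _ hg₁D, forestsW_insert_split w _ _ hg₁D,
    forestsW_insert_split w _ _ hg₂D, forestsW_insert_split w _ _ hg₂D,
    forestsW_insert_split w _ _ hg₂D, forestsW_insert_split w _ _ hg₂D,
    forestsW_insert_split w _ _ hg₂D, forestsW_insert_split w _ _ hg₂D,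
    forestsW_insert_split w _ _ hg₂D, forestsW_insert_split w _ _ hg₂D,
    (pend _ X₂).1, (pend _ X₂).2, (pend _ X₀).1, (pend _ X₀).2, (pend _ Xₑ).1, (pend _ Xₑ).2,
    (pend _ X_f).1, (pend _ X_f).2]
  -- the pinned triangle
  have tri : ∀ D' X : Finset (Sym2 V), D' ⊆ D₀ → (∀ x ∈ X, ¬x.IsDiag) → s(v, u₁) ∈ X → s(v, u₂) ∈ X →
      s(u₁, u₂) ∈ X → (∑ G ∈ D'.powerset.filter (fun G =>
        (fromEdgeSet ((G ∪ X : Finset (Sym2 V)) : Set (Sym2 V))).IsAcyclic), ∏ x ∈ G, w x) = 0 :=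
    fun D' X _ hX h₁ h₂ hh => forestsW_pin_series_triangle w D' X hX hu hvu₁ hvu₂ h₁ h₂ hh
  have ndT : ∀ X : Finset (Sym2 V), X ⊆ insert e (insert f K) →
      ∀ x ∈ insert s(v, u₂) (insert s(v, u₁) X), ¬x.IsDiag := by
    intro X hX x hx
    rcases Finset.mem_insert.1 hx with rfl | hx
    · exact fun hh => hvu₂ (Sym2.mk_isDiag_iff.1 hh)
    rcases Finset.mem_insert.1 hx with rfl | hx
    · exact fun hh => hvu₁ (Sym2.mk_isDiag_iff.1 hh)
    · exact ndX D₀ X subset_rfl hX x (Finset.mem_union_right _ hx)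
  by_cases hK : s(u₁, u₂) ∈ K
  · have spec := hred₂ (Or.inl hK)
    rw [tri D₀ _ subset_rfl (ndT _ X₂) (by simp) (by simp) (by simp [hK]),
      tri D₀ _ subset_rfl (ndT _ X₀) (by simp) (by simp) (by simp [hK]),
      tri D₀ _ subset_rfl (ndT _ Xₑ) (by simp) (by simp) (by simp [hK]),
      tri D₀ _ subset_rfl (ndT _ X_f) (by simp) (by simp) (by simp [hK])]
    simp only [mul_zero, add_zero]
    exact real_dd_scale_le spec
  by_cases he : s(u₁, u₂) = e
  · have spec := hred₂ (Or.inr he)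
    have hh₀ : s(u₁, u₂) ∉ D₀ ∪ K := by
      rw [he, Finset.mem_union, not_or]; exact ⟨heD, heK⟩
    have hh_f : s(u₁, u₂) ∉ D₀ ∪ insert f K := by
      rw [he, Finset.mem_union, Finset.mem_insert, not_or, not_or]; exact ⟨heD, hef he, heK⟩
    rw [tri D₀ _ subset_rfl (ndT _ X₂) (by simp) (by simp) (by rw [he]; simp),
      tri D₀ _ subset_rfl (ndT _ Xₑ) (by simp) (by simp) (by rw [he]; simp),
      forestsW_pin_series w D₀ K (ndX _ _ subset_rfl X₀) (hvX _ _ subset_rfl X₀) hu hvu₁ hvu₂ hh₀,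
      forestsW_pin_series w D₀ (insert f K) (ndX _ _ subset_rfl X_f) (hvX _ _ subset_rfl X_f) hu
        hvu₁ hvu₂ hh_f, he]
    simp only [mul_zero, add_zero]
    exact real_dd_e_le spec
  -- the chord activity
  have hpos : (0 : ℝ) < 1 + w s(v, u₁) + w s(v, u₂) := by linarith [hw s(v, u₁), hw s(v, u₂)]
  have hc : w s(v, u₁) * w s(v, u₂) / (1 + w s(v, u₁) + w s(v, u₂)) * (1 + w s(v, u₁) + w s(v, u₂)) = w s(v, u₁) * w s(v, u₂) :=
    div_mul_cancel₀ _ hpos.ne'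
  have hc0 : 0 ≤ w s(v, u₁) * w s(v, u₂) / (1 + w s(v, u₁) + w s(v, u₂)) :=
    div_nonneg (mul_nonneg (hw _) (hw _)) hpos.le
  by_cases hD : s(u₁, u₂) ∈ D₀
  · -- `h ∈ D₀`: split off `h` too; the chord activity is added to `w h`
    have hD' : D₀ = insert s(u₁, u₂) (D₀.erase s(u₁, u₂)) := (Finset.insert_erase hD).symm
    have hh₁ : s(u₁, u₂) ∉ D₀.erase s(u₁, u₂) := Finset.notMem_erase _ _
    have sub₁ : D₀.erase s(u₁, u₂) ⊆ D₀ := Finset.erase_subset _ _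
    have spec := hred₁ (w s(u₁, u₂) + w s(v, u₁) * w s(v, u₂) / (1 + w s(v, u₁) + w s(v, u₂)))
      (add_nonneg (hw _) hc0) hK he
    rw [forestsW_insert_split _ _ _ hh₁, forestsW_insert_split _ _ _ hh₁,
      forestsW_insert_split _ _ _ hh₁, forestsW_insert_split _ _ _ hh₁,
      forestsW_update w _ _ _ _ hh₁, forestsW_update w _ _ _ _ hh₁, forestsW_update w _ _ _ _ hh₁,
      forestsW_update w _ _ _ _ hh₁, forestsW_update w _ _ _ _ hh₁, forestsW_update w _ _ _ _ hh₁,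
      forestsW_update w _ _ _ _ hh₁, forestsW_update w _ _ _ _ hh₁, Function.update_self] at spec
    have hhX : ∀ X : Finset (Sym2 V), X ⊆ insert e (insert f K) → s(u₁, u₂) ∉ D₀.erase s(u₁, u₂) ∪ X := by
      intro X hX hx
      rcases Finset.mem_union.1 hx with hx | hx
      · exact hh₁ hx
      · have hx' := hX hx
        simp only [Finset.mem_insert] at hx'
        rcases hx' with hx' | hx' | hx'
        · exact he hx'
        · exact hhf hx'
        · exact hK hx'
    have ndT' : ∀ X : Finset (Sym2 V), X ⊆ insert e (insert f K) →
        ∀ x ∈ insert s(u₁, u₂) (insert s(v, u₂) (insert s(v, u₁) X)), ¬x.IsDiag := by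
      intro X hX x hx
      rcases Finset.mem_insert.1 hx with rfl | hx
      · exact hnd
      · exact ndT X hX x hx
    rw [hD', forestsW_insert_split w _ _ hh₁, forestsW_insert_split w _ _ hh₁,
      forestsW_insert_split w _ _ hh₁, forestsW_insert_split w _ _ hh₁,
      forestsW_insert_split w _ _ hh₁, forestsW_insert_split w _ _ hh₁,
      forestsW_insert_split w _ _ hh₁, forestsW_insert_split w _ _ hh₁,
      tri _ _ sub₁ (ndT' _ X₂) (by simp) (by simp) (by simp),
      tri _ _ sub₁ (ndT' _ X₀) (by simp) (by simp) (by simp),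
      tri _ _ sub₁ (ndT' _ Xₑ) (by simp) (by simp) (by simp),
      tri _ _ sub₁ (ndT' _ X_f) (by simp) (by simp) (by simp),
      forestsW_pin_series w _ _ (ndX _ _ sub₁ X₂) (hvX _ _ sub₁ X₂) hu hvu₁ hvu₂ (hhX _ X₂),
      forestsW_pin_series w _ _ (ndX _ _ sub₁ X₀) (hvX _ _ sub₁ X₀) hu hvu₁ hvu₂ (hhX _ X₀),
      forestsW_pin_series w _ _ (ndX _ _ sub₁ Xₑ) (hvX _ _ sub₁ Xₑ) hu hvu₁ hvu₂ (hhX _ Xₑ),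
      forestsW_pin_series w _ _ (ndX _ _ sub₁ X_f) (hvX _ _ sub₁ X_f) hu hvu₁ hvu₂ (hhX _ X_f)]
    simp only [mul_zero, add_zero]
    exact real_dd_absorb_le spec hc
  · -- `h ∉ D₀`: the chord is new
    have spec := hred₁ (w s(v, u₁) * w s(v, u₂) / (1 + w s(v, u₁) + w s(v, u₂))) hc0 hK he
    rw [Finset.erase_eq_of_notMem hD] at spec
    rw [forestsW_insert_split _ _ _ hD, forestsW_insert_split _ _ _ hD,
      forestsW_insert_split _ _ _ hD, forestsW_insert_split _ _ _ hD,
      forestsW_update w _ _ _ _ hD, forestsW_update w _ _ _ _ hD, forestsW_update w _ _ _ _ hD,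
      forestsW_update w _ _ _ _ hD, forestsW_update w _ _ _ _ hD, forestsW_update w _ _ _ _ hD,
      forestsW_update w _ _ _ _ hD, forestsW_update w _ _ _ _ hD, Function.update_self] at spec
    have hhX : ∀ X : Finset (Sym2 V), X ⊆ insert e (insert f K) → s(u₁, u₂) ∉ D₀ ∪ X := by
      intro X hX hx
      rcases Finset.mem_union.1 hx with hx | hx
      · exact hD hx
      · have hx' := hX hx
        simp only [Finset.mem_insert] at hx'
        rcases hx' with hx' | hx' | hx'
        · exact he hx'
        · exact hhf hx'
        · exact hK hx'
    rw [forestsW_pin_series w _ _ (ndX _ _ subset_rfl X₂) (hvX _ _ subset_rfl X₂) hu hvu₁ hvu₂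
        (hhX _ X₂),
      forestsW_pin_series w _ _ (ndX _ _ subset_rfl X₀) (hvX _ _ subset_rfl X₀) hu hvu₁ hvu₂
        (hhX _ X₀),
      forestsW_pin_series w _ _ (ndX _ _ subset_rfl Xₑ) (hvX _ _ subset_rfl Xₑ) hu hvu₁ hvu₂
        (hhX _ Xₑ),
      forestsW_pin_series w _ _ (ndX _ _ subset_rfl X_f) (hvX _ _ subset_rfl X_f) hu hvu₁ hvu₂
        (hhX _ X_f)]
    exact real_dd_new_le spec hc


end Summit.CriticalPhenomena.PercolationContinuityZ3.Theorems.ForestRayleigh
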